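import Summits.CriticalPhenomena.PercolationContinuityZ3.Theorems.PercAnnulusCrossingIICQuenchedPointUpper
import Summits.CriticalPhenomena.PercolationContinuityZ3.Theorems.PercAnnulusCrossingIICManyPointsOneScaleUpper
import HarnessLib

/-!
# The quenched k-point UPPER bound at one scale: `ν(H ∩ {S ⊆ C(0)}) ≤ C·(C'π(n))^{#S}·ν(H)` for separated `S`, (A2)□ alone (lane RSW3, p1 gen 20)

builds on p205010 (kernel theorem, internal audit signed; external expert review pending) — NOT used in this file
(only `p_c(ℤ^d) > 0` in the `p_c` corollary).

RSW3 lane (LANE 3 `prim-rsw3`), seat `prim-rsw3-p1` (gen 20).  Helper file (`--supports stmt-CriticalPhenomena-4575`);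
no definitions, no sorries.  Memo `run/shared/lean/prim/rsw3/P1-QM.md` §33.

`…IICQuenchedPointUpper` (one far site given the inner cluster) and `…IICManyPointsOneScaleUpper` (k separated sites at one scale,
unconditionally) merge: per atom `At_b(V,η)` the event `⋂_{z∈S}{0 ↔ z in Λ(R)}` becomes `⋂_{z∈S} C_z^R` (`C_z^R = {z ↔ Y in Λ(R) ∖ V}`), which
together with the arm off the cluster `γ_N(V,Y)` forces, on pairwise disjoint pair sets, `γ_{st}(V,Y)`, the arms `z ↔ z + ∂ⁱⁿΛ(r)` (`z ∈ S`,
balls pairwise disjoint) and the shell crossing `T(2n+r, N)`; quasi-multiplicativity of the arm off the cluster (part (3a)) prices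
`P(γ_{st})·P(T(2n+r,N)) ≤ P(γ_N)/(ϰ²w)`:

* **`mul_real_biInter_openCrossing_inter_link_le`** — `ϰ²w·P(⋂_{z∈S} C_z^R ∩ γ_N(V,Y)) ≤ π_p(r)^{#S}·P(γ_N(V,Y))`;
* **`real_inter_biInter_openConnIn_inter_siteToBoundary_le_of_saturated`** — `P(H ∩ ⋂_{z∈S}{0 ↔ z in Λ(R)} ∩ A_N) ≤ (π_p(r)^{#S}/(ϰ²w))·P(H ∩ A_N)`
  for every `H` saturated by the scale-`b` atoms;
* **`iicMeasure_real_inter_biInter_openConn_le_of_saturated`** — `ν(H ∩ {S ⊆ C(0)}) ≤ (π_p(r)^{#S}/(ϰ²w))·ν(H)` for every IIC measure `ν`;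
* **`exists_iicMeasure_real_inter_biInter_openConn_le_criticalProbI`** — at `p_c(ℤ^d)`, `d ≥ 2`, under (A2)□(s,L) ALONE: there are `C, C'`
  with **`ν(H ∩ {S ⊆ C(0)}) ≤ C·(C'·π_{p_c}(n))^{#S}·ν(H)`** for every `b ≥ 1`, every local `H` reading only the cluster of the origin inside
  `Λ(b)`, every `n ≥ 16s(b+1)` and every finite `S` with `n ≤ ‖z‖_∞ ≤ 2n` on `S` and `z − z' ∉ Λ(2⌊n/4⌋)` for distinct `z, z' ∈ S`.  With
  part (1b) (`≥ c_U(cπ(n))^{#S}ν(H)`): THE k-POINT FUNCTION OF THE IIC AT ONE SCALE FORGETS THE INSIDE, TWO-SIDEDLY.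
References: H. Kesten, Probab. Theory Relat. Fields 73 (1986) §2, Thm. (8); D. Basu, A. Sapozhnikov, ECP 22 (2017) §1–2.
-/

noncomputable section

namespace Summit.CriticalPhenomena.PercolationContinuityZ3.Theorems.Crossing

open MeasureTheory Filter Topology Literature.Probability.Percolation Literature.Probability.LatticeModels
open Literature.Probability.Percolation.DCT16
open Summit.CriticalPhenomena.PercolationContinuityZ3.Theorems.SurfaceTension

variable {d : ℕ}

/-! ## §1 The hang-off events of k separated sites given the arm off the cluster -/

/-- **k HANG-OFF EVENTS GIVEN THE ARM OFF THE CLUSTER** (every `d`, `p`; (A2)□ at aspect `(s,L)`, `2 ≤ s ≤ L`, `ϰ ≥ 0`; `V ⊆ Λ(b)`,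
`Y ⊆ Λ(b+1) ∖ Λ(b)`; `t ≥ b+1`, `1 ≤ r`, `4st ≤ n`, `4r ≤ n`; `S` finite with `n ≤ ‖z‖_∞ ≤ 2n` on `S` and `z − z' ∉ Λ(2r)` for distinct `z, z'`;
auxiliary scale `m ≥ b+1` with `Lt < sm`, `2n + r + 2 ≤ sm`, `Lm < N`; window `w ≤ P(cross(st−1, sm))`):
**`ϰ²·w·P(⋂_{z∈S} C_z^R ∩ γ_N(V,Y)) ≤ π_p(r)^{#S}·P(γ_N(V,Y))`** (witnesses `γ_{st}`, the arms in the disjoint balls, the shell crossing `T(2n+r,N)`;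
then the two quasi-multiplicativity steps of part (3a)). [cite: Kesten1986, Thm. (8)] [cite: BasuSapozhnikov2017ECP, §1 assumption (A2)] -/
theorem mul_real_biInter_openCrossing_inter_link_le (p : unitInterval) {s L : ℕ} (hs : 2 ≤ s) (hsL : s ≤ L) {ϰ : ℝ} (hϰ : 0 ≤ ϰ)
    (hA2 : SetToSetQuasiMultAspectAt d p s L ϰ) {b t r m n N R : ℕ} (ht : b + 1 ≤ t) (hr : 1 ≤ r) (hn : 4 * (s * t) ≤ n)
    (hrn : 4 * r ≤ n) (hm1 : L * t < s * m) (hm2 : 2 * n + r + 2 ≤ s * m) (hmb : b + 1 ≤ m) (hN : L * m < N)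
    {V Y : Finset (Site d)} (hV : V ⊆ box d b) (hY : Y ⊆ box d (b + 1) \ box d b)
    (S : Finset (Site d)) (hS : ∀ z ∈ S, n ≤ Site.supNorm z ∧ Site.supNorm z ≤ 2 * n)
    (hsep : ∀ z ∈ S, ∀ z' ∈ S, z ≠ z' → z - z' ∉ box d (r + r)) {w : ℝ} (hw0 : 0 ≤ w)
    (hw : w ≤ (bondPercolation (zdGraph d) p).real {ω : BondConfig (Site d) | ∃ x ∈ box d (s * t - 1),
      ∃ y ∈ innerBoundary (zdGraph d) (box d (s * m)), ω ∈ openConnIn (↑(box d (s * m)) : Set (Site d)) x y}) :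
    ϰ ^ 2 * w * (bondPercolation (zdGraph d) p).real
        ((⋂ z ∈ S, openCrossing (↑(box d R \ V) : Set (Site d)) {z} ↑Y) ∩
          {ω : BondConfig (Site d) | ∃ y ∈ Y, ∃ t' ∈ innerBoundary (zdGraph d) (box d N),
            ω ∈ openConnIn ((↑(box d N) : Set (Site d)) \ ↑V) y t'}) ≤
      oneArmProb d p r ^ S.card * (bondPercolation (zdGraph d) p).real {ω : BondConfig (Site d) | ∃ y ∈ Y,
        ∃ t' ∈ innerBoundary (zdGraph d) (box d N), ω ∈ openConnIn ((↑(box d N) : Set (Site d)) \ ↑V) y t'} := by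
  classical
  set μ := bondPercolation (zdGraph d) p with hμ
  have hsm_le_N : s * m ≤ N := le_trans (Nat.mul_le_mul_right m hsL) hN.le
  have htst : t ≤ s * t := Nat.le_mul_of_pos_left t (by omega)
  have hst1 : 1 ≤ s * t := by omega
  have hYb1 : Y ⊆ box d (b + 1) := fun y hy => (Finset.mem_sdiff.1 (hY hy)).1
  -- the three pieces
  set A : Set (BondConfig (Site d)) := {ω : BondConfig (Site d) | ∃ y ∈ Y, ∃ t' ∈ innerBoundary (zdGraph d) (box d (s * t)),
    ω ∈ openConnIn ((↑(box d (s * t)) : Set (Site d)) \ ↑V) y t'} with hA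
  set Bv : Set (BondConfig (Site d)) := ⋂ z ∈ S, DCT16.armEvent z r with hBv
  set T : Set (BondConfig (Site d)) := {ω : BondConfig (Site d) | ∃ u ∈ innerBoundary (zdGraph d) (box d (2 * n + r + 1)),
    ∃ t' ∈ innerBoundary (zdGraph d) (box d N), ω ∈ openConnIn ((↑(box d N) : Set (Site d)) \ ↑(box d (2 * n + r))) u t'} with hT
  obtain ⟨hBdet, hBm, hBprob⟩ := real_biInter_armEvent_eq_pow p r S hsep
  have hAdet : DeterminedBy A (↑((box d (s * t)).sym2) : Set (Sym2 (Site d))) := by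
    have h := determinedBy_link_sym2 (box d (s * t) \ V) Y (innerBoundary (zdGraph d) (box d (s * t)))
    rw [Finset.coe_sdiff] at h
    exact h.mono (Finset.coe_subset.2 (Finset.sym2_mono Finset.sdiff_subset))
  have hAm : MeasurableSet A := measurableSet_link_sdiff' (s * t) V Y
  have hTdet : DeterminedBy T (((↑(box d N) : Set (Site d)) \ ↑(box d (2 * n + r))).sym2) := determinedBy_tail_sdiff (2 * n + r) N
  have hTm : MeasurableSet T := (hTdet.mono (sym2_sdiff_subset_sym2_box _ _)).measurableSet_of_finset
  -- disjointness
  have hAB : Disjoint (↑((box d (s * t)).sym2) : Set (Sym2 (Site d))) (⋃ z ∈ S, {w : Site d | w - z ∈ box d r}.sym2) := by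
    rw [Set.disjoint_iUnion₂_right]
    intro z hz
    exact disjoint_sym2_box_sym2_ball (by have := (hS z hz).1; omega) (self_mem_sphere z)
  have hBT : Disjoint (⋃ z ∈ S, {w : Site d | w - z ∈ box d r}.sym2) (((↑(box d N) : Set (Site d)) \ ↑(box d (2 * n + r))).sym2) := by
    rw [Set.disjoint_iUnion₂_left]
    intro z hz
    exact disjoint_sym2_ball_sym2_sdiff (by have := (hS z hz).2; omega) (Finset.mem_filter.1 (self_mem_sphere z)).1
  have hAT : Disjoint (↑((box d (s * t)).sym2) : Set (Sym2 (Site d))) (((↑(box d N) : Set (Site d)) \ ↑(box d (2 * n + r))).sym2) :=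
    disjoint_sym2_box_sym2_sdiff_of_le (by omega) N
  -- the inclusion on lattice configurations
  have hle : μ.real ((⋂ z ∈ S, openCrossing (↑(box d R \ V) : Set (Site d)) {z} ↑Y) ∩
      {ω : BondConfig (Site d) | ∃ y ∈ Y, ∃ t' ∈ innerBoundary (zdGraph d) (box d N),
        ω ∈ openConnIn ((↑(box d N) : Set (Site d)) \ ↑V) y t'}) ≤ μ.real (A ∩ Bv ∩ T) := by
    refine real_mono_of_forall_subset_edgeSet (zdGraph d) p fun ω hω h => ?_
    obtain ⟨hC, hγ⟩ := h
    rw [Set.mem_iInter₂] at hC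
    refine ⟨⟨?_, ?_⟩, ?_⟩
    · exact link_sdiff_anti (M' := s * t) (M := N) (by omega) (hYb1.trans (box_mono d (by omega))) hω hγ
    · rw [hBv, Set.mem_iInter₂]
      intro z hz
      exact armEvent_of_openCrossing_singleton hω
        (fun y hy => sub_notMem_box_of_mem_box_of_sphere (by have := (hS z hz).1; omega) (self_mem_sphere z) (hYb1 hy)) (hC z hz)
    · exact far_of_link_sdiff hω (hYb1.trans (box_mono d (by omega))) (by omega) hγ
  -- independence
  have hprod : μ.real (A ∩ Bv ∩ T) = μ.real A * μ.real Bv * μ.real T := by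
    have hABdet : DeterminedBy (A ∩ Bv) ((↑((box d (s * t)).sym2) : Set (Sym2 (Site d))) ∪ ⋃ z ∈ S, {w : Site d | w - z ∈ box d r}.sym2) :=
      (hAdet.mono Set.subset_union_left).inter (hBdet.mono Set.subset_union_right)
    rw [bondPercolation_real_inter_of_disjoint (zdGraph d) p (Set.disjoint_union_left.2 ⟨hAT, hBT⟩) hABdet hTdet (hAm.inter hBm) hTm,
      bondPercolation_real_inter_of_disjoint (zdGraph d) p hAB hAdet hBdet hAm hBm]
  -- quasi-multiplicativity of the arm off the cluster, twice
  have hQ1 := mul_real_link_mul_cross_le_link p (by omega : 1 ≤ s) (by omega : 1 ≤ L) hϰ hA2 ht hm1 (by omega : s * t ≤ s * m) hV hY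
  have hQ2 := mul_real_link_mul_tail_le_link p (by omega : 1 ≤ L) hϰ hA2 hmb (by omega : b ≤ 2 * n + r) hm2 hN hsm_le_N hV hY
  set Psm := μ.real {ω : BondConfig (Site d) | ∃ y ∈ Y, ∃ t' ∈ innerBoundary (zdGraph d) (box d (s * m)),
    ω ∈ openConnIn ((↑(box d (s * m)) : Set (Site d)) \ ↑V) y t'} with hPsm
  set PN := μ.real {ω : BondConfig (Site d) | ∃ y ∈ Y, ∃ t' ∈ innerBoundary (zdGraph d) (box d N),
    ω ∈ openConnIn ((↑(box d N) : Set (Site d)) \ ↑V) y t'} with hPN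
  set Pcr := μ.real {ω : BondConfig (Site d) | ∃ x ∈ box d (s * t - 1),
    ∃ y ∈ innerBoundary (zdGraph d) (box d (s * m)), ω ∈ openConnIn (↑(box d (s * m)) : Set (Site d)) x y} with hPcr
  have hA0 : 0 ≤ μ.real A := measureReal_nonneg
  have hT0 : 0 ≤ μ.real T := measureReal_nonneg
  have hπk0 : 0 ≤ oneArmProb d p r ^ S.card := pow_nonneg (by unfold oneArmProb; exact measureReal_nonneg) _
  calc ϰ ^ 2 * w * μ.real _ ≤ ϰ ^ 2 * w * (μ.real A * μ.real Bv * μ.real T) := by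
        refine mul_le_mul_of_nonneg_left (hle.trans (le_of_eq hprod)) (by positivity)
    _ = ϰ * (ϰ * μ.real A * w) * (μ.real Bv * μ.real T) := by ring
    _ ≤ ϰ * (ϰ * μ.real A * Pcr) * (oneArmProb d p r ^ S.card * μ.real T) := by
        rw [hBprob]
        exact mul_le_mul_of_nonneg_right (mul_le_mul_of_nonneg_left (mul_le_mul_of_nonneg_left hw (mul_nonneg hϰ hA0)) hϰ)
          (mul_nonneg hπk0 hT0)
    _ ≤ ϰ * Psm * (oneArmProb d p r ^ S.card * μ.real T) :=
        mul_le_mul_of_nonneg_right (mul_le_mul_of_nonneg_left hQ1 hϰ) (mul_nonneg hπk0 hT0)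
    _ = oneArmProb d p r ^ S.card * (ϰ * Psm * μ.real T) := by ring
    _ ≤ oneArmProb d p r ^ S.card * PN := mul_le_mul_of_nonneg_left hQ2 hπk0

/-! ## §2 Upper transfer across the atoms -/

/-- **THE QUENCHED k-POINT UPPER BOUND AT FINITE `N`** (hypotheses of `mul_real_biInter_openCrossing_inter_link_le` with `ϰ, w > 0`): for every
event `H` reading only the cluster of the origin inside `Λ(b)` (with the states of the pairs at it) and every `R`:
**`P(H ∩ ⋂_{z∈S}{0 ↔ z in Λ(R)} ∩ A_N) ≤ (π_p(r)^{#S}/(ϰ²w)) · P(H ∩ A_N)`** (gen 17's one-step contraction with the per-atom outside events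
`⋂_{z∈S} C_z^R`). [cite: Kesten1986, §2 (2.16)] -/
theorem real_inter_biInter_openConnIn_inter_siteToBoundary_le_of_saturated (p : unitInterval) {s L : ℕ} (hs : 2 ≤ s) (hsL : s ≤ L)
    {ϰ : ℝ} (hϰ : 0 < ϰ) (hA2 : SetToSetQuasiMultAspectAt d p s L ϰ) {b t r m n N R : ℕ} (ht : b + 1 ≤ t) (hr : 1 ≤ r)
    (hn : 4 * (s * t) ≤ n) (hrn : 4 * r ≤ n) (hm1 : L * t < s * m) (hm2 : 2 * n + r + 2 ≤ s * m) (hmb : b + 1 ≤ m) (hN : L * m < N)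
    (S : Finset (Site d)) (hS : ∀ z ∈ S, n ≤ Site.supNorm z ∧ Site.supNorm z ≤ 2 * n)
    (hsep : ∀ z ∈ S, ∀ z' ∈ S, z ≠ z' → z - z' ∉ box d (r + r)) {w : ℝ} (hw0 : 0 < w)
    (hw : w ≤ (bondPercolation (zdGraph d) p).real {ω : BondConfig (Site d) | ∃ x ∈ box d (s * t - 1),
      ∃ y ∈ innerBoundary (zdGraph d) (box d (s * m)), ω ∈ openConnIn (↑(box d (s * m)) : Set (Site d)) x y})
    {H : Set (BondConfig (Site d))}
    (hH : ∀ ω ω' : BondConfig (Site d), ω ⊆ (zdGraph d).edgeSet → ω' ⊆ (zdGraph d).edgeSet →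
      (∀ x, ω ∈ openConnIn (↑(box d b) : Set (Site d)) 0 x ↔ ω' ∈ openConnIn (↑(box d b) : Set (Site d)) 0 x) →
      (∀ x y, ω ∈ openConnIn (↑(box d b) : Set (Site d)) 0 x → y ∈ box d (b + 1) → (s(x, y) ∈ ω ↔ s(x, y) ∈ ω')) →
      ω ∈ H → ω' ∈ H) :
    (bondPercolation (zdGraph d) p).real
        (H ∩ (⋂ z ∈ S, (openConnIn (↑(box d R) : Set (Site d)) (0 : Site d) z : Set (BondConfig (Site d)))) ∩ siteToBoundary d N) ≤
      oneArmProb d p r ^ S.card / (ϰ ^ 2 * w) * (bondPercolation (zdGraph d) p).real (H ∩ siteToBoundary d N) := by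
  classical
  set F : Finset (Site d) → Finset (Sym2 (Site d)) := fun V => (V ×ˢ (box d b \ V)).image fun q => s(q.1, q.2) with hFdef
  set Kf : Finset (Site d) → Finset (Sym2 (Site d)) := fun V => (V ×ˢ box d (b + 1)).image fun q => s(q.1, q.2) with hKdef
  set Y : Finset (Site d) → Finset (Sym2 (Site d)) → Finset (Site d) := fun V η =>
    (box d (b + 1) \ box d b).filter fun y => ∃ x ∈ V, s(x, y) ∈ η ∧ (zdGraph d).Adj x y with hYdef
  have hF : ∀ V e, e ∈ F V ↔ ∃ x ∈ V, ∃ y ∈ box d b, y ∉ V ∧ e = s(x, y) := by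
    intro V e
    simp only [hFdef, Finset.mem_image, Finset.mem_product, Finset.mem_sdiff, Prod.exists]
    constructor
    · rintro ⟨x, y, ⟨hx, hy, hyV⟩, rfl⟩; exact ⟨x, hx, y, hy, hyV, rfl⟩
    · rintro ⟨x, hx, y, hy, hyV, rfl⟩; exact ⟨x, y, ⟨hx, hy, hyV⟩, rfl⟩
  have hKf : ∀ V e, e ∈ Kf V ↔ ∃ x ∈ V, ∃ y ∈ box d (b + 1), e = s(x, y) := by
    intro V e
    simp only [hKdef, Finset.mem_image, Finset.mem_product, Prod.exists]
    constructor
    · rintro ⟨x, y, ⟨hx, hy⟩, rfl⟩; exact ⟨x, hx, y, hy, rfl⟩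
    · rintro ⟨x, hx, y, hy, rfl⟩; exact ⟨x, y, ⟨hx, hy⟩, rfl⟩
  have hY : ∀ V η y, y ∈ Y V η ↔ y ∈ box d (b + 1) ∧ y ∉ box d b ∧ ∃ x ∈ V, s(x, y) ∈ η ∧ (zdGraph d).Adj x y := by
    intro V η y
    rw [hYdef, Finset.mem_filter, Finset.mem_sdiff, and_assoc]
  have hYsub : ∀ V η, Y V η ⊆ box d (b + 1) \ box d b := fun V η y hy => by
    rw [Finset.mem_sdiff]; exact ⟨((hY V η y).1 hy).1, ((hY V η y).1 hy).2.1⟩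
  have hsat := atomSaturated_of_saturated (m := b) F Kf hF hKf hH
  have htst : t ≤ s * t := Nat.le_mul_of_pos_left t (by omega)
  have hzb : ∀ z ∈ S, z ∉ box d b := by
    intro z hz hzb'
    have h1 := mem_box_iff_supNorm_le.1 hzb'
    have := (hS z hz).1
    omega
  have hbN : b + 1 < N := by nlinarith
  set E : Finset (Site d) → Finset (Sym2 (Site d)) → Set (BondConfig (Site d)) := fun V η =>
    ⋂ z ∈ S, openCrossing (↑(box d R \ V) : Set (Site d)) {z} ↑(Y V η) with hE
  have hEdm : ∀ V η, DeterminedBy (E V η) (↑(Kf V) : Set (Sym2 (Site d)))ᶜ ∧ MeasurableSet (E V η) := by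
    intro V η
    have h := fun z => determinedBy_openCrossing_singleton_compl (M := R) (V := V) (Y := Y V η) (hKf V) z
    exact ⟨DeterminedBy.iInter fun z => DeterminedBy.iInter fun _ => (h z).1, Finset.measurableSet_biInter S fun z _ => (h z).2⟩
  set θ : ℝ := oneArmProb d p r ^ S.card / (ϰ ^ 2 * w) with hθ
  have hθ0 : 0 ≤ θ := div_nonneg (pow_nonneg (by unfold oneArmProb; exact measureReal_nonneg) _) (by positivity)
  refine real_inter_inter_siteToBoundary_le_of_atoms p hbN F Kf hF hKf Y hY hsat E (fun V η => (hEdm V η).2)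
    (fun V η => (hEdm V η).1) ?_ hθ0 ?_
  · intro V hVb h0 η _ ω hω hAt hT
    rw [Set.mem_iInter₂] at hT
    exact Set.mem_iInter₂.2 fun z hz =>
      openCrossing_rim_of_openConnIn_of_mem_atom hVb h0 (hF V) (hKf V) (hY V η) hω hAt (hzb z hz) (hT z hz)
  · intro V hVb _ η _
    have h := mul_real_biInter_openCrossing_inter_link_le p hs hsL hϰ.le hA2 (R := R) ht hr hn hrn hm1 hm2 hmb hN hVb (hYsub V η)
      S hS hsep hw0.le hw
    rw [hθ, div_mul_eq_mul_div, le_div_iff₀ (by positivity)]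
    calc (bondPercolation (zdGraph d) p).real (E V η ∩ _) * (ϰ ^ 2 * w)
        = ϰ ^ 2 * w * (bondPercolation (zdGraph d) p).real (E V η ∩ _) := by ring
      _ ≤ _ := h

/-! ## §3 Under the IIC -/

/-- **THE QUENCHED k-POINT UPPER BOUND FOR KESTEN'S IIC** (hypotheses of `real_inter_biInter_openConnIn_inter_siteToBoundary_le_of_saturated`):
for every finite measure `ν` with Kesten's IIC limit property and every local `H` reading only the cluster of the origin inside `Λ(b)`:
**`ν(H ∩ ⋂_{z∈S}{0 ↔ z}) ≤ (π_p(r)^{#S}/(ϰ²w)) · ν(H)`** (every localisation `Λ(R)`, then `R → ∞`). [cite: Kesten1986, Thm. (8)] -/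
theorem iicMeasure_real_inter_biInter_openConn_le_of_saturated (p : unitInterval) {s L : ℕ} (hs : 2 ≤ s) (hsL : s ≤ L)
    {ϰ : ℝ} (hϰ : 0 < ϰ) (hA2 : SetToSetQuasiMultAspectAt d p s L ϰ) {b t r m n : ℕ} (ht : b + 1 ≤ t) (hr : 1 ≤ r)
    (hn : 4 * (s * t) ≤ n) (hrn : 4 * r ≤ n) (hm1 : L * t < s * m) (hm2 : 2 * n + r + 2 ≤ s * m) (hmb : b + 1 ≤ m)
    (S : Finset (Site d)) (hS : ∀ z ∈ S, n ≤ Site.supNorm z ∧ Site.supNorm z ≤ 2 * n)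
    (hsep : ∀ z ∈ S, ∀ z' ∈ S, z ≠ z' → z - z' ∉ box d (r + r)) {w : ℝ} (hw0 : 0 < w)
    (hw : w ≤ (bondPercolation (zdGraph d) p).real {ω : BondConfig (Site d) | ∃ x ∈ box d (s * t - 1),
      ∃ y ∈ innerBoundary (zdGraph d) (box d (s * m)), ω ∈ openConnIn (↑(box d (s * m)) : Set (Site d)) x y})
    {ν : Measure (BondConfig (Site d))} [IsFiniteMeasure ν]
    (hν : ∀ (F : Finset (Sym2 (Site d))) (E : Set (BondConfig (Site d))), MeasurableSet E → DeterminedBy E ↑F →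
      Tendsto (fun n : ℕ => (bondPercolation (zdGraph d) p).real (E ∩ siteToBoundary d n) / oneArmProb d p n)
        atTop (𝓝 (ν.real E)))
    {H : Set (BondConfig (Site d))} (hHl : IsLocalEvent H)
    (hH : ∀ ω ω' : BondConfig (Site d), ω ⊆ (zdGraph d).edgeSet → ω' ⊆ (zdGraph d).edgeSet →
      (∀ x, ω ∈ openConnIn (↑(box d b) : Set (Site d)) 0 x ↔ ω' ∈ openConnIn (↑(box d b) : Set (Site d)) 0 x) →
      (∀ x y, ω ∈ openConnIn (↑(box d b) : Set (Site d)) 0 x → y ∈ box d (b + 1) → (s(x, y) ∈ ω ↔ s(x, y) ∈ ω')) →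
      ω ∈ H → ω' ∈ H) :
    ν.real (H ∩ ⋂ z ∈ S, (openConn (0 : Site d) z : Set (BondConfig (Site d)))) ≤ oneArmProb d p r ^ S.card / (ϰ ^ 2 * w) * ν.real H := by
  set θ : ℝ := oneArmProb d p r ^ S.card / (ϰ ^ 2 * w) with hθ
  have hloc : ∀ R : ℕ, ν.real (H ∩ ⋂ z ∈ S, (openConnIn (↑(box d R) : Set (Site d)) (0 : Site d) z : Set (BondConfig (Site d)))) ≤
      θ * ν.real H := by
    intro R
    have hTl : IsLocalEvent (⋂ z ∈ S, (openConnIn (↑(box d R) : Set (Site d)) (0 : Site d) z : Set (BondConfig (Site d)))) :=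
      ⟨(box d R).sym2, DeterminedBy.iInter fun z => DeterminedBy.iInter fun _ => determinedBy_openConnIn _ 0 z (by rw [Finset.coe_sym2])⟩
    have hT1 := tendsto_iicMeasure_of_isLocalEvent p hν hHl
    have hT2 := tendsto_iicMeasure_of_isLocalEvent p hν (hHl.inter hTl)
    refine le_of_tendsto_of_tendsto hT2 (hT1.const_mul θ) ?_
    rw [Filter.EventuallyLE, Filter.eventually_atTop]
    refine ⟨L * m + 1, fun N hN => ?_⟩
    have h := real_inter_biInter_openConnIn_inter_siteToBoundary_le_of_saturated p hs hsL hϰ hA2 (R := R) ht hr hn hrn hm1 hm2 hmb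
      (by omega : L * m < N) S hS hsep hw0 hw hH
    show (bondPercolation (zdGraph d) p).real (H ∩ (⋂ z ∈ S, (openConnIn (↑(box d R) : Set (Site d)) (0 : Site d) z :
        Set (BondConfig (Site d)))) ∩ siteToBoundary d N) / oneArmProb d p N ≤
      θ * ((bondPercolation (zdGraph d) p).real (H ∩ siteToBoundary d N) / oneArmProb d p N)
    by_cases hπ : oneArmProb d p N = 0
    · simp only [hπ, div_zero, mul_zero, le_refl]
    · have hπpos : 0 < oneArmProb d p N := lt_of_le_of_ne (by unfold oneArmProb; exact measureReal_nonneg) (Ne.symm hπ)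
      rw [← mul_div_assoc, div_le_div_iff_of_pos_right hπpos]
      exact h
  -- `R → ∞`
  set Ev : ℕ → Set (BondConfig (Site d)) := fun R =>
    H ∩ ⋂ z ∈ S, (openConnIn (↑(box d R) : Set (Site d)) (0 : Site d) z : Set (BondConfig (Site d))) with hEv
  have hmono : Monotone Ev := by
    intro R R' hRR' ω hω
    refine ⟨hω.1, ?_⟩
    have h2 := hω.2
    simp only [Set.mem_iInter₂] at h2 ⊢
    exact fun z hz => openConnIn_mono (Finset.coe_subset.2 (box_mono d hRR')) 0 z (h2 z hz)
  have hsub : H ∩ (⋂ z ∈ S, (openConn (0 : Site d) z : Set (BondConfig (Site d)))) ⊆ ⋃ R, Ev R := by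
    rintro ω ⟨hωH, hω⟩
    obtain ⟨R, hR⟩ := exists_biInter_openConnIn_of_biInter_openConn_finset S hω
    exact Set.mem_iUnion.2 ⟨R, hωH, hR⟩
  have hθH : 0 ≤ θ * ν.real H :=
    mul_nonneg (div_nonneg (pow_nonneg (by unfold oneArmProb; exact measureReal_nonneg) _) (by positivity)) measureReal_nonneg
  have hEb : ∀ R, ν (Ev R) ≤ ENNReal.ofReal (θ * ν.real H) := by
    intro R
    rw [← ofReal_measureReal]
    exact ENNReal.ofReal_le_ofReal (hloc R)
  have hlim := tendsto_measure_iUnion_atTop (μ := ν) hmono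
  have hle : ν (⋃ R, Ev R) ≤ ENNReal.ofReal (θ * ν.real H) := le_of_tendsto' hlim hEb
  exact ENNReal.toReal_le_of_le_ofReal hθH ((measure_mono hsub).trans hle)

/-! ## §4 At `p_c(ℤ^d)` -/

/-- **THE QUENCHED k-POINT UPPER BOUND AT ONE SCALE, ON `ℤ^d` UNDER (A2)□ ALONE** (`p_c(ℤ^d)`, `d ≥ 2`; (A2)□ at aspect `(s,L)`, `2 ≤ s ≤ L`,
`ϰ > 0`): there are `C, C' > 0` such that for every finite measure `ν` with Kesten's IIC limit property at `p_c(ℤ^d)`, every inner scale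
`b ≥ 1`, every local event `H` reading only the cluster of the origin inside `Λ(b)`, every `n ≥ 16s(b+1)` and every finite set of sites
`S` with `n ≤ ‖z‖_∞ ≤ 2n` on `S` and `z − z' ∉ Λ(2⌊n/4⌋)` for distinct `z, z' ∈ S`: **`ν(H ∩ {S ⊆ C(0)}) ≤ C·(C'·π_{p_c}(n))^{#S}·ν(H)`**.  With
part (1b) (`c_U(cπ_{p_c}(n))^{#S}ν(H) ≤ ν(H ∩ {S ⊆ C(0)})`, (A2)□ + `CU⁺_l` + UAD) the k-point function of the IIC at one scale FORGETS THE
INSIDE, two-sidedly. [cite: Kesten1986, Thm. (8)] [cite: BasuSapozhnikov2017ECP, Thm. 1.1] -/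
theorem exists_iicMeasure_real_inter_biInter_openConn_le_criticalProbI (hd : 2 ≤ d) {s L : ℕ} (hs : 2 ≤ s) (hsL : s ≤ L)
    {ϰ : ℝ} (hϰ : 0 < ϰ) (hA2 : SetToSetQuasiMultAspectAt d (criticalProbI d) s L ϰ) :
    ∃ C C' : ℝ, 0 < C ∧ 0 < C' ∧ ∀ (ν : Measure (BondConfig (Site d))) [IsFiniteMeasure ν],
      (∀ (F : Finset (Sym2 (Site d))) (E : Set (BondConfig (Site d))), MeasurableSet E → DeterminedBy E ↑F →
        Tendsto (fun n : ℕ => (bondPercolation (zdGraph d) (criticalProbI d)).real (E ∩ siteToBoundary d n) /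
          oneArmProb d (criticalProbI d) n) atTop (𝓝 (ν.real E))) →
      ∀ (b : ℕ), 1 ≤ b → ∀ (H : Set (BondConfig (Site d))), IsLocalEvent H →
        (∀ ω ω' : BondConfig (Site d), ω ⊆ (zdGraph d).edgeSet → ω' ⊆ (zdGraph d).edgeSet →
          (∀ x, ω ∈ openConnIn (↑(box d b) : Set (Site d)) 0 x ↔ ω' ∈ openConnIn (↑(box d b) : Set (Site d)) 0 x) →
          (∀ x y, ω ∈ openConnIn (↑(box d b) : Set (Site d)) 0 x → y ∈ box d (b + 1) → (s(x, y) ∈ ω ↔ s(x, y) ∈ ω')) →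
          ω ∈ H → ω' ∈ H) →
        ∀ n : ℕ, 16 * s * (b + 1) ≤ n → ∀ S : Finset (Site d), (∀ z ∈ S, n ≤ Site.supNorm z ∧ Site.supNorm z ≤ 2 * n) →
          (∀ z ∈ S, ∀ z' ∈ S, z ≠ z' → z - z' ∉ box d (n / 4 + n / 4)) →
            ν.real (H ∩ ⋂ z ∈ S, (openConn (0 : Site d) z : Set (BondConfig (Site d)))) ≤
              C * (C' * oneArmProb d (criticalProbI d) n) ^ S.card * ν.real H := by
  have hd1 : 1 ≤ d := le_trans (by norm_num) hd
  obtain ⟨B, hB, hR2⟩ := Rsw3.exists_oneArmProb_ratio_of_setToSetQuasiMultAspectAt hd hs hsL hϰ hA2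
  set w : ℝ := (2 * (d : ℝ))⁻¹ * ((1 : ℝ) / (16 * (L + 24))) ^ (d - 1) with hw
  have hwpos : 0 < w := by positivity
  refine ⟨1 / (ϰ ^ 2 * w), B, by positivity, hB, fun ν _ hν b hb H hHl hH n hn S hS hsep => ?_⟩
  -- scales: `t = ⌊n/(4s)⌋`, `r = ⌊n/4⌋`, `m = (L+23)t + 1`
  have hn16 : 4 * s * (b + 1) ≤ n := le_trans (Nat.mul_le_mul_right _ (by omega)) hn
  obtain ⟨ht, h4, h8⟩ := div4s_scale_bounds (by omega : 1 ≤ s) hn16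
  set t := n / (4 * s) with htdef
  have hn8 : 8 ≤ n := le_trans (by nlinarith) hn
  obtain ⟨hr, hrn, hnr⟩ := div4_scale_bounds hn8
  set r := n / 4 with hrdef
  have ht1 : 1 ≤ t := by omega
  have hst1 : 1 ≤ s * t := Nat.succ_le_of_lt (Nat.mul_pos (by omega) (by omega))
  set m : ℕ := (L + 23) * t + 1 with hm
  have hm1 : L * t < s * m := by rw [hm]; nlinarith
  have hm2 : 2 * n + r + 2 ≤ s * m := by rw [hm]; nlinarith
  have hmb : b + 1 ≤ m := by rw [hm]; nlinarith
  -- the window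
  have hst2 : 2 ≤ s * t := le_trans (by omega : 2 ≤ s * 1) (Nat.mul_le_mul_left s ht1)
  have hcross_le : s * t - 1 ≤ s * m := by omega
  have hwin := Rsw3.le_real_boxCrossing_criticalProbI_of_le hd (by omega : 1 ≤ s * t - 1) hcross_le
  have hw_le : w ≤ (bondPercolation (zdGraph d) (criticalProbI d)).real {ω : BondConfig (Site d) | ∃ x ∈ box d (s * t - 1),
      ∃ y ∈ innerBoundary (zdGraph d) (box d (s * m)), ω ∈ openConnIn (↑(box d (s * m)) : Set (Site d)) x y} := by
    rw [real_cross_eq_real_boxCrossing _ hcross_le]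
    refine le_trans ?_ hwin
    rw [hw]
    refine mul_le_mul_of_nonneg_left (pow_le_pow_left₀ (by positivity) ?_ _) (by positivity)
    rw [div_le_div_iff₀ (by positivity) (by positivity), one_mul]
    have h1 : ((s * t - 1 : ℕ) : ℝ) = (s : ℝ) * t - 1 := by
      rw [Nat.cast_sub hst1]; push_cast; ring
    have h2 : ((s * m : ℕ) : ℝ) = (s : ℝ) * ((L : ℝ) + 23) * t + s := by rw [hm]; push_cast; ring
    rw [h1, h2]
    have hS2 : (2 : ℝ) ≤ (s : ℝ) * t := by exact_mod_cast hst2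
    have hsL' : (s : ℝ) ≤ L := by exact_mod_cast hsL
    nlinarith [mul_nonneg (sub_nonneg.2 hS2) (by positivity : (0 : ℝ) ≤ 12 * (L : ℝ) + 292)]
  have h := iicMeasure_real_inter_biInter_openConn_le_of_saturated (criticalProbI d) hs hsL hϰ hA2 ht hr h4 hrn hm1 hm2 hmb S hS hsep
    hwpos hw_le hν hHl hH
  -- `π(r) ≤ B π(n)` (`n ≤ 8r`)
  have hratio : oneArmProb d (criticalProbI d) r ≤ B * oneArmProb d (criticalProbI d) n := hR2 r n hr (by omega) hnr
  have hπr0 : 0 ≤ oneArmProb d (criticalProbI d) r := by unfold oneArmProb; exact measureReal_nonneg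
  calc ν.real (H ∩ ⋂ z ∈ S, (openConn (0 : Site d) z : Set (BondConfig (Site d))))
      ≤ oneArmProb d (criticalProbI d) r ^ S.card / (ϰ ^ 2 * w) * ν.real H := h
    _ ≤ (B * oneArmProb d (criticalProbI d) n) ^ S.card / (ϰ ^ 2 * w) * ν.real H :=
        mul_le_mul_of_nonneg_right (div_le_div_of_nonneg_right (pow_le_pow_left₀ hπr0 hratio _) (by positivity)) measureReal_nonneg
    _ = 1 / (ϰ ^ 2 * w) * (B * oneArmProb d (criticalProbI d) n) ^ S.card * ν.real H := by ring

end Summit.CriticalPhenomena.PercolationContinuityZ3.Theorems.Crossing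

end
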